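import Summits.QuantumFields.GaugeBoot.ClassB
import Summits.QuantumFields.GaugeBoot.LatticeWords
import Literature.MathematicalPhysics.QuantumFieldTheory.ConstructiveQFTWave0Proofs
import HarnessLib

/-!
# Words, holonomies and loop variables on the infinite lattice `ℤ^d`; Class-B Gram and RP blocks (gauge-boot L3(α), part 2)

HONEST FRAMING (cell `pub-gaugeboot`): certified bounds on lattice expectations at stated coupling,
gauge group, dimension and torus size; NOT a mass gap, NOT a continuum limit, NOT a string tension;
NOT Yang–Mills-summit-bearing (barriers `FixedCouplingUltralocality`, `PerturbativeInvisibility`).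

`LatticeWords.lean` (task L1's word layer) types steps, words and holonomies over the TORUS
(`Site d L`, `GaugeConfig d L G`). The Class-B interface (`ClassB.lean`) lives on the infinite
lattice (`LGConfig d G = ZdEdge d → G`, `Literature.MathematicalPhysics.QuantumLattice`). This module is
the mechanical `ℤ^d` port of the word layer (same `Step d` / `Word d`, `Zd`-suffixed names) plus the
two facts a Class-B certificate consumes besides the loop equations:

* `Step.applyZd`, `Step.edgeZd`, `Word.endpointZd`, `stepHolonomyZd`, `wordHolonomyZd` with the glue
  `wordHolonomyZd_append`, `wordHolonomyZd_reverse`, `wordHolonomyZd_backtrack`;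
* `wordLoopZd ρ x w U = (1/N) Re tr ρ(hol)` with `abs_wordLoopZd_le_one` (the a-priori bound
  `|y_v| ≤ 1` of the certificates), measurability (no countability assumption on `G`), integrability
  for every finite measure;
* **`sum_mul_integral_wordLoopZd_nonneg`** — Gram ("Hermitian") positivity of based closed words for
  EVERY probability measure on `LGConfig d G` (so in particular for `ω.μ`, `ω : ClassBState d ρ β`):
  `0 ≤ Σᵢⱼ cᵢ cⱼ ∫ W_x(Oᵢ⁻¹·Oⱼ) dμ` — the `H` blocks;
* **`ClassBState.rpBlock_nonneg`** — for a Class-B state, each of the three reflection-positivity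
  AXIOMS turns a finite family of bounded measurable half-supported observables into a PSD block
  (restatement of `IsReflectionPositiveFor.sum_mul_conj_nonneg` at the three fields `siteRP`,
  `linkRP`, `diagRP`) — the `R_site` / `R_link` / `R_diag` blocks.

Not here: the loop equations for Class-B states (from `IsHaarShiftState` by the word calculus of task
L1 — `WordDerivative.lean` ff., to be typed over `LGConfig`), and the support bookkeeping that a
concrete `R`-block's Wilson-line entries are `DependsOn … (halfEdges)` (generator-side data).
Proof patterns follow `WordLoop.lean` (lean1) verbatim. All `[folklore]`.

UPDATE (2026-08-28): the loop equations for Class-B states ARE now derived, from `IsHaarShiftState`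
alone, over `LGConfig`: `ZdPlaquetteInsertion.lean` → `ZdSchwingerDyson.lean` → `ZdLoopEquation.lean` →
`ZdLoopEquationStates.lean` (`ClassBState.loopEquation_pairForm_suN` / `_uN`, and
`IsHaarShiftState.loopEquation_pairForm_suN` / `_uN` for every Haar-shift state, in this file's
`wordHolonomyZd` vocabulary).
-/

noncomputable section

open MeasureTheory Complex
open scoped ComplexOrder Matrix
open Literature.Probability.LatticeModels (Site)
open Literature.MathematicalPhysics.QuantumLattice
open Literature.MathematicalPhysics.QuantumFieldTheory (WilsonRP.EntryMeasurable)
open Literature.RepresentationTheory.CompactGroups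

namespace Summit.QuantumFields.GaugeBoot

variable {d : ℕ}

/-! ## Steps and words on `ℤ^d` -/

namespace Step

/-- Endpoint of the step taken from `x ∈ ℤ^d`. [folklore] -/
def applyZd (x : Site d) : Step d → Site d
  | fwd μ => x + Pi.single μ 1
  | bwd μ => x - Pi.single μ 1

/-- The positively oriented edge of `ℤ^d` traversed by the step taken from `x`. [folklore] -/
def edgeZd (x : Site d) : Step d → ZdEdge d
  | fwd μ => (x, μ)
  | bwd μ => (x - Pi.single μ 1, μ)

/-- Unfolding lemma. [folklore] -/
@[simp] theorem applyZd_fwd (x : Site d) (μ : Fin d) : (fwd μ).applyZd x = x + Pi.single μ 1 := rfl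
/-- Unfolding lemma. [folklore] -/
@[simp] theorem applyZd_bwd (x : Site d) (μ : Fin d) : (bwd μ).applyZd x = x - Pi.single μ 1 := rfl
/-- Unfolding lemma. [folklore] -/
@[simp] theorem edgeZd_fwd (x : Site d) (μ : Fin d) : (fwd μ).edgeZd x = (x, μ) := rfl
/-- Unfolding lemma. [folklore] -/
@[simp] theorem edgeZd_bwd (x : Site d) (μ : Fin d) : (bwd μ).edgeZd x = (x - Pi.single μ 1, μ) := rfl

/-- A step and its reverse cancel on sites. [folklore] -/
@[simp] theorem applyZd_inv_applyZd (x : Site d) (s : Step d) : s.inv.applyZd (s.applyZd x) = x := by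
  cases s <;> simp [Step.applyZd, Step.inv]

end Step

namespace Word

/-- Endpoint on `ℤ^d` of the word started at `x`. [folklore] -/
def endpointZd : Site d → Word d → Site d
  | x, [] => x
  | x, s :: w => endpointZd (s.applyZd x) w

/-- Unfolding lemma. [folklore] -/
@[simp] theorem endpointZd_nil (x : Site d) : endpointZd x ([] : Word d) = x := rfl

/-- Unfolding lemma. [folklore] -/
@[simp] theorem endpointZd_cons (x : Site d) (s : Step d) (w : Word d) :
    endpointZd x (s :: w) = endpointZd (s.applyZd x) w := rfl

/-- Endpoint of a concatenation. [folklore] -/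
theorem endpointZd_append (x : Site d) (v w : Word d) :
    endpointZd x (v ++ w) = endpointZd (endpointZd x v) w := by
  induction v generalizing x with
  | nil => rfl
  | cons s v ih => simp [ih]

/-- The reversed word returns to the base point. [folklore] -/
@[simp] theorem endpointZd_reverse (x : Site d) (w : Word d) :
    endpointZd (endpointZd x w) (reverse w) = x := by
  induction w generalizing x with
  | nil => rfl
  | cons s w ih => simp [reverse_cons, endpointZd_append, ih]

end Word

/-! ## Holonomies on `ℤ^d` -/

section Holonomy

variable {G : Type*} [Group G]

/-- Holonomy of one step from `x`: `U(x, μ)` forward, `U(x − e_μ, μ)⁻¹` backward. [folklore] -/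
def stepHolonomyZd (U : LGConfig d G) (x : Site d) : Step d → G
  | .fwd μ => U (x, μ)
  | .bwd μ => (U (x - Pi.single μ 1, μ))⁻¹

/-- Holonomy of a word from `x` (ordered product, left to right). [folklore] -/
def wordHolonomyZd (U : LGConfig d G) : Site d → Word d → G
  | _, [] => 1
  | x, s :: w => stepHolonomyZd U x s * wordHolonomyZd U (s.applyZd x) w

/-- Unfolding lemma. [folklore] -/
@[simp] theorem stepHolonomyZd_fwd (U : LGConfig d G) (x : Site d) (μ : Fin d) :
    stepHolonomyZd U x (.fwd μ) = U (x, μ) := rfl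

/-- Unfolding lemma. [folklore] -/
@[simp] theorem stepHolonomyZd_bwd (U : LGConfig d G) (x : Site d) (μ : Fin d) :
    stepHolonomyZd U x (.bwd μ) = (U (x - Pi.single μ 1, μ))⁻¹ := rfl

/-- Unfolding lemma. [folklore] -/
@[simp] theorem wordHolonomyZd_nil (U : LGConfig d G) (x : Site d) :
    wordHolonomyZd U x ([] : Word d) = 1 := rfl

/-- Unfolding lemma. [folklore] -/
@[simp] theorem wordHolonomyZd_cons (U : LGConfig d G) (x : Site d) (s : Step d) (w : Word d) :
    wordHolonomyZd U x (s :: w) = stepHolonomyZd U x s * wordHolonomyZd U (s.applyZd x) w := rfl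

/-- Holonomy is multiplicative under concatenation. [folklore] -/
theorem wordHolonomyZd_append (U : LGConfig d G) (x : Site d) (v w : Word d) :
    wordHolonomyZd U x (v ++ w) = wordHolonomyZd U x v * wordHolonomyZd U (Word.endpointZd x v) w := by
  induction v generalizing x with
  | nil => simp
  | cons s v ih => simp [ih, mul_assoc]

/-- The reverse step from the endpoint carries the inverse holonomy. [folklore] -/
@[simp] theorem stepHolonomyZd_applyZd_inv (U : LGConfig d G) (x : Site d) (s : Step d) :
    stepHolonomyZd U (s.applyZd x) s.inv = (stepHolonomyZd U x s)⁻¹ := by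
  cases s <;> simp [Step.applyZd, Step.inv, stepHolonomyZd]

/-- The reversed word carries the inverse holonomy. [folklore] -/
theorem wordHolonomyZd_reverse (U : LGConfig d G) (x : Site d) (w : Word d) :
    wordHolonomyZd U (Word.endpointZd x w) (Word.reverse w) = (wordHolonomyZd U x w)⁻¹ := by
  induction w generalizing x with
  | nil => simp
  | cons s w ih => simp [Word.reverse_cons, wordHolonomyZd_append, ih, mul_inv_rev]

/-- Backtracks cancel. [folklore] -/
theorem wordHolonomyZd_backtrack (U : LGConfig d G) (x : Site d) (v w : Word d) (s : Step d) :
    wordHolonomyZd U x (v ++ [s, s.inv] ++ w) = wordHolonomyZd U x (v ++ w) := by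
  simp [wordHolonomyZd_append]

/-- The plaquette word has the tree's `ℤ^d` plaquette holonomy (orientation convention pinned). [folklore] -/
theorem wordHolonomyZd_plaquette (U : LGConfig d G) (x : Site d) (i j : Fin d) :
    wordHolonomyZd U x (Word.plaquette i j) = plaquetteHolonomyZd U x i j := by
  have h1 : x + Pi.single i 1 + Pi.single j 1 - Pi.single i 1 = x + Pi.single j (1 : ℤ) := by abel
  have h2 : x + Pi.single j (1 : ℤ) - Pi.single j 1 = x := by simp
  simp [Word.plaquette, stepHolonomyZd, Step.applyZd, plaquetteHolonomyZd, h1, h2, mul_assoc]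

end Holonomy

/-! ## Loop variables on `ℤ^d` -/

section LoopVariable

variable {N : ℕ} {G : Type*} [Group G] [TopologicalSpace G] [IsTopologicalGroup G] [CompactSpace G]
  [MeasurableSpace G] [BorelSpace G] (ρ : G →* Matrix (Fin N) (Fin N) ℂ)

/-- The loop variable `W_x(w)(U) = (1/N) Re tr ρ(hol_x(w)(U))` on `ℤ^d` configurations. [folklore] -/
def wordLoopZd (x : Site d) (w : Word d) (U : LGConfig d G) : ℝ :=
  (N : ℝ)⁻¹ * (ρ (wordHolonomyZd U x w)).trace.re

omit [TopologicalSpace G] [IsTopologicalGroup G] [CompactSpace G] [MeasurableSpace G] [BorelSpace G] in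
/-- Unfolding lemma. [folklore] -/
theorem wordLoopZd_apply (x : Site d) (w : Word d) (U : LGConfig d G) :
    wordLoopZd ρ x w U = (N : ℝ)⁻¹ * (ρ (wordHolonomyZd U x w)).trace.re := rfl

omit [MeasurableSpace G] [BorelSpace G] in
/-- `|W_x(w)| ≤ 1` — the a-priori bound `ρ_v = 1` of the certificates. [folklore] -/
theorem abs_wordLoopZd_le_one (hρ : Continuous ρ) (x : Site d) (w : Word d) (U : LGConfig d G) :
    |wordLoopZd ρ x w U| ≤ 1 := by
  unfold wordLoopZd
  have h := CompactGroup.abs_re_trace_le_card ρ hρ (wordHolonomyZd U x w)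
  rw [Fintype.card_fin] at h
  rcases Nat.eq_zero_or_pos N with hN | hN
  · subst hN; simp
  · rw [abs_mul, abs_inv, Nat.abs_cast]
    calc (N : ℝ)⁻¹ * |(ρ (wordHolonomyZd U x w)).trace.re| ≤ (N : ℝ)⁻¹ * N := by gcongr
      _ = 1 := inv_mul_cancel₀ (by exact_mod_cast hN.ne')

omit [CompactSpace G] in
/-- Word holonomies on `ℤ^d` are entry-measurable for the product σ-algebra. [folklore] -/
theorem entryMeasurable_wordHolonomyZd (hρ : Continuous ρ) :
    ∀ (w : Word d) (x : Site d), WilsonRP.EntryMeasurable ρ fun U : LGConfig d G => wordHolonomyZd U x w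
  | [], x => fun k l => by simp only [wordHolonomyZd_nil, map_one]; exact measurable_const
  | s :: w, x => by
    have hs : WilsonRP.EntryMeasurable ρ fun U : LGConfig d G => stepHolonomyZd U x s := by
      cases s with
      | fwd μ =>
        simpa using (Literature.MathematicalPhysics.QuantumFieldTheory.WilsonRP.entryMeasurable_apply hρ
          (x, μ))
      | bwd μ =>
        simpa using (Literature.MathematicalPhysics.QuantumFieldTheory.WilsonRP.entryMeasurable_apply_inv
          hρ (x - Pi.single μ 1, μ))
    simpa using hs.mul (entryMeasurable_wordHolonomyZd hρ w (s.applyZd x))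

omit [CompactSpace G] in
/-- `W_x(w)` is measurable on `LGConfig d G`. [folklore] -/
theorem measurable_wordLoopZd (hρ : Continuous ρ) (x : Site d) (w : Word d) :
    Measurable (wordLoopZd (d := d) (G := G) ρ x w) :=
  (entryMeasurable_wordHolonomyZd ρ hρ w x).measurable_trace_re.const_mul _

/-- `W_x(w)` is integrable for every finite measure on `LGConfig d G`. [folklore] -/
theorem integrable_wordLoopZd (hρ : Continuous ρ) (μ : Measure (LGConfig d G)) [IsFiniteMeasure μ]
    (x : Site d) (w : Word d) : Integrable (wordLoopZd ρ x w) μ :=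
  Integrable.of_bound (measurable_wordLoopZd ρ hρ x w).aestronglyMeasurable 1
    (ae_of_all _ fun U => by rw [Real.norm_eq_abs]; exact abs_wordLoopZd_le_one ρ hρ x w U)

/-- `|∫ W_x(w) dμ| ≤ 1` for a probability measure. [folklore] -/
theorem abs_integral_wordLoopZd_le_one (hρ : Continuous ρ) (μ : Measure (LGConfig d G))
    [IsProbabilityMeasure μ] (x : Site d) (w : Word d) : |∫ U, wordLoopZd ρ x w U ∂μ| ≤ 1 := by
  calc |∫ U, wordLoopZd ρ x w U ∂μ| ≤ ∫ U, |wordLoopZd ρ x w U| ∂μ := abs_integral_le_integral_abs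
    _ ≤ ∫ _U, (1 : ℝ) ∂μ := integral_mono (integrable_wordLoopZd ρ hρ μ x w).abs (integrable_const _)
        fun U => abs_wordLoopZd_le_one ρ hρ x w U
    _ = 1 := by simp

end LoopVariable

/-! ## Gram positivity for any probability measure on `LGConfig d G` (the Class-B `H` blocks) -/

section Gram

variable {N : ℕ} {G : Type*} [Group G] [TopologicalSpace G] [IsTopologicalGroup G] [CompactSpace G]
  [MeasurableSpace G] [BorelSpace G] (ρ : G →* Matrix (Fin N) (Fin N) ℂ)

omit [MeasurableSpace G] [BorelSpace G] in
/-- Pointwise Gram positivity of based closed words on `ℤ^d` (as `WordLoop.sum_mul_wordLoop_nonneg`). [folklore] -/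
theorem sum_mul_wordLoopZd_nonneg (hρ : Continuous ρ) (x : Site d) {n : ℕ} (O : Fin n → Word d)
    (hO : ∀ i, Word.endpointZd x (O i) = x) (c : Fin n → ℝ) (U : LGConfig d G) :
    0 ≤ ∑ i, ∑ j, c i * c j * wordLoopZd ρ x (Word.reverse (O i) ++ O j) U := by
  set σ := CompactGroup.unitarize ρ hρ with hσ
  set h : Fin n → G := fun i => wordHolonomyZd U x (O i) with hh
  have hhol : ∀ i j, wordHolonomyZd U x (Word.reverse (O i) ++ O j) = (h i)⁻¹ * h j := by
    intro i j
    rw [wordHolonomyZd_append]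
    have h1 := wordHolonomyZd_reverse U x (O i)
    have h2 := Word.endpointZd_reverse x (O i)
    rw [hO i] at h1 h2
    rw [h1, h2]
  have htr : ∀ i j, (ρ ((h i)⁻¹ * h j)).trace = ((σ (h i))ᴴ * σ (h j)).trace := by
    intro i j
    rw [← CompactGroup.trace_unitarize ρ hρ, map_mul, CompactGroup.unitarize_inv,
      Matrix.star_eq_conjTranspose]
  set M : Matrix (Fin N) (Fin N) ℂ := ∑ j, (c j : ℂ) • σ (h j) with hM
  have hMsum : (Mᴴ * M).trace = ∑ i, ∑ j, (c i : ℂ) * (c j : ℂ) * ((σ (h j))ᴴ * σ (h i)).trace := by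
    simp only [hM, Matrix.conjTranspose_sum, Matrix.conjTranspose_smul, Complex.star_def,
      Complex.conj_ofReal, Finset.sum_mul, Finset.mul_sum, Matrix.smul_mul, Matrix.mul_smul,
      Matrix.trace_sum, Matrix.trace_smul, smul_eq_mul]
    exact Finset.sum_congr rfl fun i _ => Finset.sum_congr rfl fun j _ => by ring
  have hpsd : 0 ≤ ((Mᴴ * M).trace).re := by
    have h0 : (0 : ℂ) ≤ (Mᴴ * M).trace := (Matrix.posSemidef_conjTranspose_mul_self M).trace_nonneg
    exact (Complex.nonneg_iff.mp h0).1
  have hre : ((Mᴴ * M).trace).re = ∑ i, ∑ j, c i * c j * ((σ (h j))ᴴ * σ (h i)).trace.re := by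
    rw [hMsum, Complex.re_sum]
    refine Finset.sum_congr rfl fun i _ => ?_
    rw [Complex.re_sum]
    refine Finset.sum_congr rfl fun j _ => ?_
    rw [← Complex.ofReal_mul, Complex.re_ofReal_mul]
  have hexpr : ∑ i, ∑ j, c i * c j * wordLoopZd ρ x (Word.reverse (O i) ++ O j) U =
      (N : ℝ)⁻¹ * ((Mᴴ * M).trace).re := by
    rw [hre, Finset.sum_comm, Finset.mul_sum]
    refine Finset.sum_congr rfl fun i _ => ?_
    rw [Finset.mul_sum]
    refine Finset.sum_congr rfl fun j _ => ?_
    rw [wordLoopZd_apply, hhol, htr]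
    ring
  rw [hexpr]
  exact mul_nonneg (inv_nonneg.2 (Nat.cast_nonneg N)) hpsd

/-- **Gram positivity of based closed words for EVERY probability measure on `ℤ^d` configurations**
(in particular for the measure of a Class-B state): `0 ≤ Σᵢⱼ cᵢ cⱼ ∫ W_x(Oᵢ⁻¹ · Oⱼ) dμ`. [folklore] -/
theorem sum_mul_integral_wordLoopZd_nonneg (hρ : Continuous ρ) (μ : Measure (LGConfig d G))
    [IsProbabilityMeasure μ] (x : Site d) {n : ℕ} (O : Fin n → Word d)
    (hO : ∀ i, Word.endpointZd x (O i) = x) (c : Fin n → ℝ) :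
    0 ≤ ∑ i, ∑ j, c i * c j * ∫ U, wordLoopZd ρ x (Word.reverse (O i) ++ O j) U ∂μ := by
  have hint : ∀ i j, Integrable (fun U => c i * c j * wordLoopZd ρ x (Word.reverse (O i) ++ O j) U) μ :=
    fun i j => (integrable_wordLoopZd ρ hρ μ x _).const_mul _
  have hswap : ∑ i, ∑ j, c i * c j * ∫ U, wordLoopZd ρ x (Word.reverse (O i) ++ O j) U ∂μ
      = ∫ U, ∑ i, ∑ j, c i * c j * wordLoopZd ρ x (Word.reverse (O i) ++ O j) U ∂μ := by
    rw [integral_finsetSum _ fun i _ => integrable_finsetSum _ fun j _ => hint i j]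
    refine Finset.sum_congr rfl fun i _ => ?_
    rw [integral_finsetSum _ fun j _ => hint i j]
    refine Finset.sum_congr rfl fun j _ => ?_
    rw [integral_const_mul]
  rw [hswap]
  exact integral_nonneg fun U => sum_mul_wordLoopZd_nonneg ρ hρ x O hO c U

/-- **Class-B `H` block.** For a Class-B state `ω`, the Gram matrix of based closed words
`(∫ W_x(Oᵢ⁻¹ · Oⱼ) dω.μ)ᵢⱼ` is positive semidefinite. [folklore] -/
theorem ClassBState.gramBlock_nonneg {β : ℝ} (ω : ClassBState d ρ β) (hρ : Continuous ρ) (x : Site d)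
    {n : ℕ} (O : Fin n → Word d) (hO : ∀ i, Word.endpointZd x (O i) = x) (c : Fin n → ℝ) :
    0 ≤ ∑ i, ∑ j, c i * c j * ∫ U, wordLoopZd ρ x (Word.reverse (O i) ++ O j) U ∂ω.μ := by
  haveI := ω.isProbabilityMeasure
  exact sum_mul_integral_wordLoopZd_nonneg ρ hρ ω.μ x O hO c

end Gram

/-! ## Reflection-positivity blocks of a Class-B state -/

section RP

variable {N : ℕ} {G : Type*} [Group G] [MeasurableSpace G] [TopologicalSpace G]
  (ρ : G →* Matrix (Fin N) (Fin N) ℂ)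

/-- **Class-B `R` blocks.** For a Class-B state `ω`, each reflection-positivity axiom (site planes
`x_i = 0`, link planes `x_i = ½`, diagonal planes `x_i = x_j`) makes the block
`(∫ (F_a∘Θ)‾ F_b dω.μ)_{ab}` positive semidefinite for every finite family of bounded measurable
observables `F_a` supported in the corresponding closed half (`…HalfEdges`), provided the reflection
map is measurable (it is for `[MeasurableInv G]`, in particular for topological groups with their Borel
σ-algebra). Restates `IsReflectionPositiveFor.sum_mul_conj_nonneg` at the three fields. [folklore] -/
theorem ClassBState.rpBlock_nonneg {β : ℝ} (ω : ClassBState d ρ β)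
    {Θ : LGConfig d G → LGConfig d G} {S : Set (ZdEdge d)}
    (hΘS : (∃ i, Θ = configSiteReflect i ∧ S = siteHalfEdges i) ∨
      (∃ i, Θ = configLinkReflect i ∧ S = linkHalfEdges i) ∨
      (∃ i j, i ≠ j ∧ Θ = configDiagSwapZd i j ∧ S = diagHalfEdges i j))
    (hΘ : Measurable Θ) {n : ℕ} (F : Fin n → LGConfig d G → ℂ) (hF : ∀ a, Measurable (F a))
    (hFb : ∀ a, ∃ C : ℝ, ∀ U, ‖F a U‖ ≤ C) (hFS : ∀ a, DependsOn (F a) S) (c : Fin n → ℂ) :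
    0 ≤ ∑ a, ∑ b, (starRingEnd ℂ) (c a) * c b *
      ∫ U, (starRingEnd ℂ) (F a (Θ U)) * F b U ∂ω.μ := by
  haveI := ω.isProbabilityMeasure
  have hRP : IsReflectionPositiveFor Θ S ω.μ := by
    rcases hΘS with ⟨i, rfl, rfl⟩ | ⟨i, rfl, rfl⟩ | ⟨i, j, hij, rfl, rfl⟩
    · exact ω.siteRP i
    · exact ω.linkRP i
    · exact ω.diagRP i j hij
  exact hRP.sum_mul_conj_nonneg hΘ F hF hFb hFS c

end RP

end Summit.QuantumFields.GaugeBoot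

end
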